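import Mathlib
import Summits.Ventures.HodgeRepro.Tier4.Common.CongruenceAdeles
import Summits.Ventures.HodgeRepro.Tier4.Common.CompactOpenLevel

/-!
# Tier4/Line4/LevelIntersection — F-L4-PHASE-PPOWER, the kernel fact: along the powers of ONE prime the congruence
sets do NOT shrink to zero — `⋂_N modSet (p^N) = {x : x_v = 0 for v | p, x_v integral for v ∤ p}`

Blind re-derivation cell `pub-hodge-repro`, Tier 4 «prove the step» (README §9–§10), seat t4-L4-p1 (prover, LINE L4,
gen 4; the finding S15478 on plan-4 g5's C-L4-PHASE sketch).  Tree path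
`lean/Summits/Ventures/HodgeRepro/Tier4/Line4/LevelIntersection.lean`.  Mathlib-level; no literature.

WHAT IS PROVED.  `mem_modSet_pow_forall_iff`: for `p ≠ 0`, a finite adele lies in `modSet (p^N)` for EVERY `N` iff its
component vanishes at every place `v` with `|p|_v < 1` (the places above `p`) and is integral at every other place.
Hence the intersection of the level groups `K(p^N)` along the `p`-powers is NOT `{1}` but the group of elements trivial at
`p` and integral away from `p` — the level fibre of the (7b) witness along `lev n = p^{n+n₁}` shrinks to the
`p`-stabiliser only, and the phase alignment `hδ` of (S-MAIN) cannot come from «`⋂_N K(N) = {1}`» (the finding).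
(Along `N!`, all primes, the intersection IS `{0}` — the repair (R1)'s kernel half, not typed here.)

Nothing here says anything about the status of the Hodge conjecture for CM abelian varieties, which is NOT proved
(HC_CM is NOT proved by anyone in this repository).
-/

set_option autoImplicit false

noncomputable section

namespace Summit.Ventures.HodgeRepro.Tier4.Line4

open Summit.Ventures.HodgeRepro.Tier4.Common NumberField IsDedekindDomain

section Intersection

variable (k : Type) [Field k] [NumberField k]

/-- **The intersection of the congruence sets along the powers of one prime**: `x ∈ modSet (p^N)` for every `N` iff
`x_v = 0` at the places above `p` (`|p|_v < 1`) and `|x_v| ≤ 1` everywhere. -/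
theorem mem_modSet_pow_forall_iff {p : ℕ} (hp : p ≠ 0) (x : FiniteAdeleRing (𝓞 k) k) :
    (∀ N : ℕ, x ∈ modSet k (p ^ N)) ↔
      ∀ v : HeightOneSpectrum (𝓞 k), (natSize k v p < 1 → x v = 0) ∧ Valued.v (x v) ≤ 1 := by
  constructor
  · intro h v
    refine ⟨fun hv => ?_, ?_⟩
    · by_contra hx
      have hγ : Valued.v (x v) ≠ 0 := (Valuation.ne_zero_iff _).2 hx
      obtain ⟨n, hn⟩ := exists_pow_lt_of_lt_one' (natSize_ne_zero k v hp) hv hγ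
      have := h n v
      rw [natSize_pow] at this
      exact absurd (lt_of_le_of_lt this hn) (lt_irrefl _)
    · have := h 0 v
      rwa [natSize_pow, pow_zero] at this
  · intro h N v
    obtain ⟨h0, h1⟩ := h v
    rw [natSize_pow]
    rcases lt_or_eq_of_le (natSize_le_one k v p) with hlt | heq
    · rw [h0 hlt, Valuation.map_zero]
      exact zero_le
    · rw [heq, one_pow]
      exact h1

end Intersection

end Summit.Ventures.HodgeRepro.Tier4.Line4

end
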